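import Summits.QuantumFields.YangMills.Theorems.BalabanUVNodesN15SiteCurvedColouredLayer
import HarnessLib

/-!
# Route «BalabanUVNodes», cluster K4 «SpineRates» — node N15 = NE2: THE SITE LAYER WITH THE BACKGROUND LIVE IN THE TwoGrid ENTRY CURRENCY, XXXVI — THE OPERATOR LAYER OF THE
# CURVED KING FAMILY: the four (3.42) η-DIFFERENCE ENTRY OPERATORS of King's massless propagator `G′ ⊗ 1` dressed by the EXACT adjoint transporters `Ad(e^{η′A′})` (parts XXX–XXXV's
# one-step King family), their [B9] `KernelFamily`, the (3.42)-SHAPED rows of entries 0 AND 1 from part XXXII's pair defect, and `NE2PlusOperator` BY NAME with the rows of entries 2∕3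
# DISPLAYED

Cell `pub-ymgap`, WIDTH SEAT `pub-ymgap-dag-n15-w1` (generation 5; director-ym №197 ∕ HUMAN RULING D-0149, №219 (1); chair R455 (A) ∕ R461; dag-lead KEY MAP v2 INBOX l.35754;
the located sequel (o1) of dag-n15-e g15 INBOX l.39322 ∕ l.39620, CLAIM-1 l.39605).  `bears_on: R4∕N15 · K3⁸ SpineGivenEndpointR13SepCoPHV (stmt-QuantumFields-27366; K3⁷ 20544
aside = lineage)`.  Filed `--supports stmt-QuantumFields-27366 --as helper` — COUNT-NEUTRAL.  Plumbing `def`s (the paired instances `curvPI`, the entry-1 layers `curvDxF∕curvDxC`,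
the sources `curvSrcF∕curvSrcC`, the Laplacians `curvLapF∕curvLapC`, the entry operators `curvOpT`, the kernel family `curvKop`), the rest theorems; 0 `sorry`.  Imports BY NAME
part XXXIII `…N15SiteCurvedColouredLayer` (p638155: `curvCube`, `curvBgF∕curvBgC`, `curvPairing`, `curvXfo∕curvXco`, `curvXco_avg`, `theta_le_two_rpow`; through it part XXXII
`uN_hasMaj_idef_curvDressed_kingTorus_king_field_closed_massRange`, dag-n15-e's `KingVolIndex`, dag-n15-w3's `curvDressed`), n15-b's `…N15OperatorReadout` (`opGeo`, `opFamily`,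
`ne2PlusOperator_of_hasMaj`), `…N15BackgroundLayerEntriesOfLetters` (`idef_projO_comp`, `entryMajorant_le_etaRateShape`), dag-n15-c's B2 (`projO`, `hasMaj_projO_comp`),
n15-b's `fgrad ∕ bgrad ∕ fgradAdj`; nothing in the tree is modified.

WHY.  Parts XXX–XXXV typed the SITE layer of this family (`NE2PlusSite` every colour entry); an `N15At` bundle (dag-n15-e's Λ pattern) also wants the OPERATOR layer
`NE2PlusOperator` — the four sup entries of [Balaban1985BackgroundPropagators] Thm 3.1 (3.42) p. 397 for the η-DIFFERENCE family.  The dressed pair `X̂ = (1 − ĜV̂)⁻¹Ĝ` carries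
the dressed propagator `pr₀X̂` AND its forward covariant derivatives `pr_{inl μ}X̂` (dag-n15-w3 `curvDressed`, (3.64)), so entries 0 and 1 are COMPONENTS of part XXXII's pair defect
(dag-n15-c B2 `hasMaj_projO_comp`); entry 2 (`X∇*_ν`, source derivative) and entry 3 (Laplacian) are CONSTRUCTED here as operators and their (3.42) rows DISPLAYED: entry 3 reduces to
dag-n15-e's Laplacian letters (Σ-a `hasMaj_kingLapOp` ∕ `hasMaj_idef_kingLapOp`) through n15-b B3 `hasMaj_idef_bgDerivedV` (`Δ₁X = ΔG + ΔG·V̂X̂`) — not typed here; entry 2 through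
the stacked pair would read the MIXED kernel `∇G∇*`, which has NO `K`-uniform ℓ^∞ block letter in King's model (Calderón–Zygmund, dag-n15-e g15 INBOX l.39620 (B)) — the dressed
(3.42)₂ entry needs the Hölder companions (3.43)–(3.45), exactly as [B9] Thm 3.1 carries them; the cell's `EtaRateIneq342` shape has no Hölder slot, so entry 2 stays DISPLAYED (located,
not owed by a landed letter).

CONTENTS.  §1 data: `curvPI` (part XXXIII's realised paired instance, literal), `curvDxF∕curvDxC` (`pr_{inl μ} ∘ curvDressed`), `curvSrcF∕curvSrcC` (`N∇*_ν ⊗ 1`), `curvLapF∕curvLapC`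
(`N²Δ ⊗ 1`), `curvOpT` (the four η-difference operators `[𝔇(X′, X̄), 𝔇(D_μX′, D_μX̄), 𝔇(X′∇′*_μ, X̄∇*_μ), 𝔇(Δ′X′, ΔX̄)]`, index `KingVolIndex d × Fin (d+1)`), `curvKop` (`opFamily`);
§2 `curvDxC_avg`, `unitTorusGeoS_len_eq`, ★★ `curvOp_letters01` (ONE `(δ_O, C_O, a₁)`: for every index, `α₀ > 0`, `M_sz·α₀ ≤ a₁`, `A′ ∈ Reg335 c₃₅ α₀`: entries 0 and 1 have the block
majorant `C_O·(L^K)^{−¼}·e^{−δ_O|y−y′|_T}`); §3 ★★ `ne2PlusOperator_curvKop_of_rows23` (`NE2PlusOperator c₃₅ curvPI curvKop` BY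
NAME from the displayed rows of entries 2 and 3; entries 0∕1 discharged by §2; `M₅ = 1`, `γ = ¼`, domination n15-b `entryMajorant_le_etaRateShape`).

HONEST FRAMING ∕ LIMITS.  Count-neutral KNIT of LANDED theorems + two DISPLAYED rows; no new analytic estimate.  MODEL-LEVEL: King's `A = 0` massless propagator (periodic b.c.,
`U ≡ 1` averaging) dressed by the exact adjoint transporter of a small potential on ONE blocking step, coarse potential = block mean (not Bałaban's (3.8)), FLAT base point, King's
torus pairing; entry 3 is the FLAT Laplacian `N²Δ ⊗ 1` of the dressed propagator (the covariant one differs by the species, dag-n15-w3 FILE `…BackgroundCovariantEntries`).  NOT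
Bałaban's `G(U)` at a (3.35)-regular `U` of the datum; nothing of [B5]∕[B6]∕[B9] asserted ((3.35)–(3.37) p. 396, Thm 3.1 (3.42)–(3.45) pp. 397–398, (3.50)–(3.53) p. 400, (3.63)–(3.65)
pp. 402–403, Thm 3.14 pp. 426–427 = SHAPES ∕ MECHANISM ∕ TEMPLATE; [King1986] p. 664, Prop. 3.9 (3.73) p. 665, (4.1)–(4.5) p. 670 = TEMPLATE).  NE2⁺ NOT PRINTED ∕ NOT proved for
d = 4; **N15 is NOT discharged**; K3⁸ OPEN, not claimed, skeleton v6 untouched (its N15 pin is `fullGSizedObjects`; nothing here re-pins); counts of record UNMOVED (typed 28∕28 ·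
discharged 5∕27, A 5∕28); one finite four-torus programme at fixed `ε` — NOT ℝ⁴, NOT infinite volume, NOT OS, NOT a mass gap, NOT Clay; R4 closes the conditional finite-𝕋⁴ rung
`BalabanLadder.UV` only.  Restate-immune (no Theses import).
-/

set_option autoImplicit false

noncomputable section
open scoped BigOperators Matrix Matrix.Norms.Frobenius

namespace Summit.QuantumFields.YangMills.BalabanUVNodes.N15.SiteLayerBg

open Real Finset NormedSpace
open Literature.MathematicalPhysics.QuantumFieldTheory.Balaban1983to89
open Literature.MathematicalPhysics.QuantumFieldTheory.Balaban1983to89.B11SectG (BlockNorm HasMaj RowSum)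
open Literature.MathematicalPhysics.QuantumFieldTheory.Balaban1983to89.T4EtaRate (PairedInstance EtaPairing NE2PlusOperator EtaRateIneq342 rateFactor)
open Literature.MathematicalPhysics.QuantumFieldTheory.Balaban1983to89.T4EtaRateDefect (idef idef_apply idef_comp rateWeight)
open Literature.MathematicalPhysics.QuantumFieldTheory.Balaban1983to89.T4EtaRateCoeffDefect (pull pull_apply)
open Literature.MathematicalPhysics.QuantumFieldTheory.Balaban1983to89.B5Prop11Plancherel (Tor fine unitVec)
open Literature.MathematicalPhysics.QuantumFieldTheory.Balaban1983to89.B6UnitTorusCarrier (unitTorusGeo unitTorusGeo_len)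
open Literature.MathematicalPhysics.QuantumFieldTheory.King1986.Torus (blockOf tdistT tdistT_nonneg)
open Literature.MathematicalPhysics.QuantumFieldTheory.Balaban1983to89.Beta.AveragingCorrectionJets (adCLM)
open Literature.Barriers.QuantumFields (traceForm)
open Summit.QuantumFields.YangMills.BalabanUVNodes.N15.VectorPiece (unitTorusGeoS rateWeight_unitTorusGeoS)
open Summit.QuantumFields.YangMills.BalabanUVNodes.N15.MatrixSpecies (liftMap liftBlk liftEquiv)
open Summit.QuantumFields.YangMills.BalabanUVNodes.N15.BackgroundLayer (fgrad bgrad fgradAdj liftPair blkPair projO fineGeo hasMaj_projO_comp idef_projO_comp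
  entryMajorant_le_etaRateShape)
open Summit.QuantumFields.YangMills.BalabanUVNodes.N15.OperatorReadout (opGeo opFamily realisedInstance ne2PlusOperator_of_hasMaj)
open Summit.QuantumFields.YangMills.BalabanUVNodes.N15.CurvedSpecies (torStep blockMeanField curvDressed expTrField)
open Summit.QuantumFields.YangMills.BalabanUVNodes.N15KingModelRung (KingVolIndex)
open Summit.QuantumFields.YangMills.BalabanUVNodes.N15KingModelRung.Curved

variable {d : ℕ} (L : ℕ) [NeZero L]
variable {n : Type} [Fintype n] [DecidableEq n] (κ : Type) [Fintype κ] [DecidableEq κ] (e : Matrix n n ℂ ≃L[ℝ] (κ → ℝ)) (a : ℝ)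

/-! ## §1 The paired instances, the entry-1 layers, the sources, the Laplacians, the four η-difference entry operators, the kernel family -/

section Data

/-- **THE PAIRED INSTANCE OF AN INDEX** (part XXXIII's literal: realised operator geometry on the coloured coarse torus, fine geometry one scale finer, the potential windows, the
pairing). [cite: Balaban1985BackgroundPropagators, Thm 3.14 pp.426–427 (typing template)] -/
abbrev curvPI (n : Type) [Fintype n] [DecidableEq n] (i : KingVolIndex d) : PairedInstance :=
  ⟨opGeo (unitTorusGeoS L i.K (curvCube L i) i.Msz) (Tor (fine (L ^ i.K) (curvCube L i)) × κ) (liftBlk (blockOf (L ^ i.K) (curvCube L i)) κ),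
    fineGeo (unitTorusGeoS L i.K (curvCube L i) i.Msz) (Tor (fine L (fine (L ^ i.K) (curvCube L i))) × κ)
      (liftBlk (blockOf (L ^ i.K) (curvCube L i) ∘ blockOf L (fine (L ^ i.K) (curvCube L i))) κ) 1,
    curvBgC L n i, curvBgF L n i, curvPairing L κ i⟩

/-- **THE FINE ENTRY-1 LAYER** `D_μX′(A′) = pr_{inl μ} ∘ curvDressed(η′, e^{η′ ad A′}; G′₁ ⊗ 1)`: the forward covariant derivative (flat base point: the plain forward quotient) of the
dressed fine propagator = the pair's `some (inl μ)` component. [cite: Balaban1985BackgroundPropagators, (3.42) p.397 (second entry), (3.64) p.403 (shape)] -/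
def curvDxF (i : KingVolIndex d) (A' : (curvBgF L n i).Cfg) (μ : Fin (d + 1)) :
    (Tor (fine L (fine (L ^ i.K) (curvCube L i))) × κ → ℝ) →ₗ[ℝ] (Tor (fine L (fine (L ^ i.K) (curvCube L i))) × κ → ℝ) :=
  projO (some (Sum.inl μ) : Option (Fin (d + 1) ⊕ Fin (d + 1))) ∘ₗ
    curvDressed ((L : ℝ) ^ (i.K + 1))⁻¹ (torStep (fine L (fine (L ^ i.K) (curvCube L i)))) (expTrField e ((L : ℝ) ^ (i.K + 1))⁻¹ 0)
      (expTrField e ((L : ℝ) ^ (i.K + 1))⁻¹ (fun μ y' => adCLM ℝ (A' μ y'))) (kingGT₁ L a 0 i.K (curvCube L i) κ)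

/-- **THE COARSE ENTRY-1 LAYER** `D_μX(V) = pr_{inl μ} ∘ curvDressed(η, e^{η ad V}; G′ ⊗ 1)`. [cite: Balaban1985BackgroundPropagators, (3.42) p.397 (second entry), (3.64) p.403 (shape)] -/
def curvDxC (i : KingVolIndex d) (V : (curvBgC L n i).Cfg) (μ : Fin (d + 1)) :
    (Tor (fine (L ^ i.K) (curvCube L i)) × κ → ℝ) →ₗ[ℝ] (Tor (fine (L ^ i.K) (curvCube L i)) × κ → ℝ) :=
  projO (some (Sum.inl μ) : Option (Fin (d + 1) ⊕ Fin (d + 1))) ∘ₗ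
    curvDressed ((L : ℝ) * ((L : ℝ) ^ (i.K + 1))⁻¹) (torStep (fine (L ^ i.K) (curvCube L i))) (expTrField e ((L : ℝ) * ((L : ℝ) ^ (i.K + 1))⁻¹) 0)
      (expTrField e ((L : ℝ) * ((L : ℝ) ^ (i.K + 1))⁻¹) (fun μ y => adCLM ℝ (V μ y))) (kingGT L a 0 i.K (curvCube L i) κ)

/-- THE FINE SOURCE `N′∇′*_ν ⊗ 1` (`(∇*_νλ)(z) = N′(λ(z − e_ν) − λ(z))`, `N′ = L^{K+1}`): the (3.42)₂ source factor. [cite: Balaban1985BackgroundPropagators, (3.42) p.397 (third entry, shape)] -/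
def curvSrcF (i : KingVolIndex d) (ν : Fin (d + 1)) :
    (Tor (fine L (fine (L ^ i.K) (curvCube L i))) × κ → ℝ) →ₗ[ℝ] (Tor (fine L (fine (L ^ i.K) (curvCube L i))) × κ → ℝ) :=
  fgradAdj ((L : ℝ) ^ (i.K + 1)) (liftEquiv (torStep (fine L (fine (L ^ i.K) (curvCube L i))) ν) κ)

/-- THE COARSE SOURCE `N∇*_ν ⊗ 1` (`N = L^K`). [cite: Balaban1985BackgroundPropagators, (3.42) p.397 (third entry, shape)] -/
def curvSrcC (i : KingVolIndex d) (ν : Fin (d + 1)) :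
    (Tor (fine (L ^ i.K) (curvCube L i)) × κ → ℝ) →ₗ[ℝ] (Tor (fine (L ^ i.K) (curvCube L i)) × κ → ℝ) :=
  fgradAdj ((L : ℝ) ^ i.K) (liftEquiv (torStep (fine (L ^ i.K) (curvCube L i)) ν) κ)

/-- THE FINE FLAT LAPLACIAN `N′²Δ′ ⊗ 1 = N′·Σ_μ(∇⁺_μ − ∇⁻_μ)`: the (3.42)₃ left factor (flat; the covariant one differs by the species). [cite: Balaban1985BackgroundPropagators, (3.42) p.397 (fourth entry, shape)] -/
def curvLapF (i : KingVolIndex d) :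
    (Tor (fine L (fine (L ^ i.K) (curvCube L i))) × κ → ℝ) →ₗ[ℝ] (Tor (fine L (fine (L ^ i.K) (curvCube L i))) × κ → ℝ) :=
  ((L : ℝ) ^ (i.K + 1)) • ∑ μ : Fin (d + 1), (fgrad ((L : ℝ) ^ (i.K + 1)) (liftEquiv (torStep (fine L (fine (L ^ i.K) (curvCube L i))) μ) κ) -
    bgrad ((L : ℝ) ^ (i.K + 1)) (liftEquiv (torStep (fine L (fine (L ^ i.K) (curvCube L i))) μ) κ))

/-- THE COARSE FLAT LAPLACIAN `N²Δ ⊗ 1`. [cite: Balaban1985BackgroundPropagators, (3.42) p.397 (fourth entry, shape)] -/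
def curvLapC (i : KingVolIndex d) :
    (Tor (fine (L ^ i.K) (curvCube L i)) × κ → ℝ) →ₗ[ℝ] (Tor (fine (L ^ i.K) (curvCube L i)) × κ → ℝ) :=
  ((L : ℝ) ^ i.K) • ∑ μ : Fin (d + 1), (fgrad ((L : ℝ) ^ i.K) (liftEquiv (torStep (fine (L ^ i.K) (curvCube L i)) μ) κ) -
    bgrad ((L : ℝ) ^ i.K) (liftEquiv (torStep (fine (L ^ i.K) (curvCube L i)) μ) κ))

/-- **THE FOUR η-DIFFERENCE ENTRY OPERATORS** of the index `(i, μ)` at a fine potential `A′` (coarse member at the block mean `Ā′ = avg A′`): coarse test function `λ` on the coloured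
coarse torus ↦ the fine-lattice functions `X′(τλ) − (X̄λ)∘π`, `D_μX′(τλ) − (D_μX̄λ)∘π`, `X′∇′*_μ(τλ) − (X̄∇*_μλ)∘π`, `Δ′X′(τλ) − (ΔX̄λ)∘π` (`τλ = λ∘π`, King's pairing).
[cite: Balaban1985BackgroundPropagators, Thm 3.1 (3.42) p.397 (the four sup entries: shape), Thm 3.14 pp.426–427 (η-pair template); King1986, p.664 (pairing)] -/
def curvOpT (i : KingVolIndex d × Fin (d + 1)) :
    Fin 4 → (curvBgF L n i.1).Cfg → ((Tor (fine (L ^ i.1.K) (curvCube L i.1)) × κ → ℝ) →ₗ[ℝ] (Tor (fine L (fine (L ^ i.1.K) (curvCube L i.1))) × κ → ℝ)) :=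
  ![fun A' => idef (pull (liftMap (blockOf L (fine (L ^ i.1.K) (curvCube L i.1))) κ)) (pull (liftMap (blockOf L (fine (L ^ i.1.K) (curvCube L i.1))) κ))
      (curvXfo L κ e a i.1 A') (curvXco L κ e a i.1 ((curvPairing L κ i.1).avg A')),
    fun A' => idef (pull (liftMap (blockOf L (fine (L ^ i.1.K) (curvCube L i.1))) κ)) (pull (liftMap (blockOf L (fine (L ^ i.1.K) (curvCube L i.1))) κ))
      (curvDxF L κ e a i.1 A' i.2) (curvDxC L κ e a i.1 ((curvPairing L κ i.1).avg A') i.2),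
    fun A' => idef (pull (liftMap (blockOf L (fine (L ^ i.1.K) (curvCube L i.1))) κ)) (pull (liftMap (blockOf L (fine (L ^ i.1.K) (curvCube L i.1))) κ))
      (curvXfo L κ e a i.1 A' ∘ₗ curvSrcF L κ i.1 i.2) (curvXco L κ e a i.1 ((curvPairing L κ i.1).avg A') ∘ₗ curvSrcC L κ i.1 i.2),
    fun A' => idef (pull (liftMap (blockOf L (fine (L ^ i.1.K) (curvCube L i.1))) κ)) (pull (liftMap (blockOf L (fine (L ^ i.1.K) (curvCube L i.1))) κ))
      (curvLapF L κ i.1 ∘ₗ curvXfo L κ e a i.1 A') (curvLapC L κ i.1 ∘ₗ curvXco L κ e a i.1 ((curvPairing L κ i.1).avg A'))]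

/-- **THE [B9] KERNEL FAMILY OF THE CURVED KING FAMILY** (n15-b `opFamily`: entry `e n A′ λ y` = the sup over the fine cube `y` of the n-th η-difference operator applied to `λ`;
Hölder ∕ L² ∕ global entries inert). [cite: Balaban1985BackgroundPropagators, (3.42) p.397 (entries: shape)] -/
def curvKop (i : KingVolIndex d × Fin (d + 1)) : B9.KernelFamily (curvPI L κ n i.1).gc (curvPI L κ n i.1).Bf :=
  opFamily (g := unitTorusGeoS L i.1.K (curvCube L i.1) i.1.Msz) (liftBlk (blockOf (L ^ i.1.K) (curvCube L i.1)) κ)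
    (liftBlk (blockOf (L ^ i.1.K) (curvCube L i.1) ∘ blockOf L (fine (L ^ i.1.K) (curvCube L i.1))) κ) (curvOpT L κ e a i)

end Data

/-! ## §2 ★★ The (3.42)-shaped rows of entries 0 and 1 — components of part XXXII's pair defect -/

section Letters01

/-- THE COARSE ENTRY-1 LAYER AT THE AVERAGED POTENTIAL IS THE PAIR's COARSE COMPONENT (`blockMean 0 = 0`, `blockMean(ad ∘ A′) = ad ∘ blockMean A′`; part XXXIII `curvXco_avg`'s twin).
[folklore] -/
theorem curvDxC_avg (i : KingVolIndex d) (A' : (curvBgF L n i).Cfg) (μ : Fin (d + 1)) :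
    curvDxC L κ e a i ((curvPairing L κ i).avg A') μ = projO (some (Sum.inl μ) : Option (Fin (d + 1) ⊕ Fin (d + 1))) ∘ₗ
      curvDressed ((L : ℝ) * ((L : ℝ) ^ (i.K + 1))⁻¹) (torStep (fine (L ^ i.K) (curvCube L i)))
        (expTrField e ((L : ℝ) * ((L : ℝ) ^ (i.K + 1))⁻¹) (blockMeanField L (fine (L ^ i.K) (curvCube L i)) 0))
        (expTrField e ((L : ℝ) * ((L : ℝ) ^ (i.K + 1))⁻¹) (blockMeanField L (fine (L ^ i.K) (curvCube L i)) (fun μ y' => adCLM ℝ (A' μ y'))))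
        (kingGT L a 0 i.K (curvCube L i) κ) := by
  rw [blockMeanField_zero, blockMeanField_adCLM]
  rfl

omit [NeZero L] in
/-- The sized unit-torus carrier's sites have size `L^Kη = 1`. [folklore] -/
theorem unitTorusGeoS_len_eq (hL0 : L ≠ 0) (K : ℕ) (M : Fin (d + 1) → ℕ) [∀ μ, NeZero (M μ)] (Msz : ℝ) (y : (unitTorusGeoS L K M Msz).Site) :
    (unitTorusGeoS L K M Msz).len y = 1 := by
  show (L : ℝ) ^ K * ((L : ℝ) ^ K)⁻¹ = 1
  exact mul_inv_cancel₀ (pow_ne_zero _ (Nat.cast_ne_zero.mpr hL0))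

/-- ★★ **THE (3.42)-SHAPED ROWS OF ENTRIES 0 AND 1, ONE CONSTANT BLOCK.**  For odd `L ≥ 3`, `a > 0`, trace-form-orthonormal coordinates `e` of `M_N(ℂ)` and any `c₃₅` there are
`δ_O, C_O, a₁ > 0` such that for every index `i`, every `α₀ > 0` with `M_sz·α₀ ≤ a₁` and every potential `A′` in the window `Reg335 c₃₅ α₀`: the η-difference operators of entry 0
(`𝔇(X′, X̄)`) and of entry 1 in every direction (`𝔇(D_μX′, D_μX̄)`) have the block majorant `C_O·(L^K)^{−¼}·e^{−δ_O|y−y′|_T}` from the sharp coloured coarse cubes to the fine ones —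
part XXXII's pair defect at `(γ, α) = (½, ½)` (`(L^K)^{−¼} + (L^K)^{−½} ≤ 2(L^K)^{−¼}`) through dag-n15-c's B2 `hasMaj_projO_comp` at `none` and at `some (inl μ)`.
[cite: Balaban1985BackgroundPropagators, Thm 3.1 (3.42) p.397 (first two entries: shape), (3.35) p.396, (3.63)–(3.65) pp.402–403 (mechanism); King1986, Prop. 3.9 (3.73) p.665 (rate template)] -/
theorem curvOp_letters01 (he : ∀ X Y : Matrix n n ℂ, traceForm X Y = e X ⬝ᵥ e Y) (hLodd : Odd L) (hL : 2 ≤ L) (ha : 0 < a) (c35 : ℝ) :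
    ∃ δO C a₁ : ℝ, 0 < δO ∧ 0 < C ∧ 0 < a₁ ∧
      ∀ (i : KingVolIndex d) (α₀ : ℝ), 0 < α₀ → i.Msz * α₀ ≤ a₁ → ∀ U : (curvBgF L n i).Cfg, (curvBgF L n i).Reg335 c35 α₀ U →
        HasMaj (BlockNorm.ofBlocks (unitTorusGeoS L i.K (curvCube L i) i.Msz) (liftBlk (blockOf (L ^ i.K) (curvCube L i)) κ))
            (BlockNorm.ofBlocks (unitTorusGeoS L i.K (curvCube L i) i.Msz) (liftBlk (blockOf (L ^ i.K) (curvCube L i) ∘ blockOf L (fine (L ^ i.K) (curvCube L i))) κ))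
            (idef (pull (liftMap (blockOf L (fine (L ^ i.K) (curvCube L i))) κ)) (pull (liftMap (blockOf L (fine (L ^ i.K) (curvCube L i))) κ))
              (curvXfo L κ e a i U) (curvXco L κ e a i ((curvPairing L κ i).avg U)))
            (fun y y' => C * ((L : ℝ) ^ i.K) ^ (-(1 / 4 : ℝ)) * Real.exp (-(δO * tdistT (curvCube L i) y y'))) ∧
        ∀ μ : Fin (d + 1),
          HasMaj (BlockNorm.ofBlocks (unitTorusGeoS L i.K (curvCube L i) i.Msz) (liftBlk (blockOf (L ^ i.K) (curvCube L i)) κ))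
            (BlockNorm.ofBlocks (unitTorusGeoS L i.K (curvCube L i) i.Msz) (liftBlk (blockOf (L ^ i.K) (curvCube L i) ∘ blockOf L (fine (L ^ i.K) (curvCube L i))) κ))
            (idef (pull (liftMap (blockOf L (fine (L ^ i.K) (curvCube L i))) κ)) (pull (liftMap (blockOf L (fine (L ^ i.K) (curvCube L i))) κ))
              (curvDxF L κ e a i U μ) (curvDxC L κ e a i ((curvPairing L κ i).avg U) μ))
            (fun y y' => C * ((L : ℝ) ^ i.K) ^ (-(1 / 4 : ℝ)) * Real.exp (-(δO * tdistT (curvCube L i) y y'))) := by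
  obtain ⟨δ₄, C₄, a₄, hδ₄, hC₄, ha₄, H₄⟩ := uN_hasMaj_idef_curvDressed_kingTorus_king_field_closed_massRange (d := d) L e he hLodd hL ha le_rfl (γ := 1 / 2) (by norm_num)
    (by norm_num) (α := 1 / 2) (by norm_num) (by norm_num)
  have hL1 : 1 ≤ L := by omega
  have hLr : (0 : ℝ) ≤ (L : ℝ) := Nat.cast_nonneg _
  set cp : ℝ := max c35 0 with hcdef
  have hcp : 0 ≤ cp := le_max_right _ _
  have hcpc : c35 ≤ cp := le_max_left _ _
  refine ⟨δ₄ / 2, 2 * C₄, a₄ / (cp + 1), half_pos hδ₄, by positivity, div_pos ha₄ (by linarith), fun i α₀ hα₀ hMα U hreg => ?_⟩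
  obtain ⟨hskew, hA, hgradA, hsecA⟩ := hreg
  -- the small-field bound `t = cp·(M_sz α₀) ≤ a₄`
  set s : ℝ := i.Msz * α₀ with hsdef
  have hs0 : 0 ≤ s := mul_nonneg (le_trans zero_le_one i.one_le_Msz) hα₀.le
  set t : ℝ := cp * s with htdef
  have hct : c35 * s ≤ t := mul_le_mul_of_nonneg_right hcpc hs0
  have hta₄ : t ≤ a₄ := by
    have h1 : t ≤ (cp + 1) * (a₄ / (cp + 1)) := by rw [htdef]; nlinarith [hMα]
    have h2 : (cp + 1) * (a₄ / (cp + 1)) = a₄ := by field_simp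
    linarith
  have hA' : ∀ μ y', ‖U μ y'‖ ≤ a₄ := fun μ y' => ((hA μ y').trans hct).trans hta₄
  have hgradA' : ∀ μ ν y', ‖U μ y' - U μ (y' - unitVec (fine L (fine (L ^ i.K) (curvCube L i))) ν)‖ ≤ ((L : ℝ) ^ (i.K + 1))⁻¹ * a₄ :=
    fun μ ν y' => (hgradA μ ν y').trans (mul_le_mul_of_nonneg_left (hct.trans hta₄) (by positivity))
  have hsecA' : ∀ μ ν (z' : Tor (fine L (fine (L ^ i.K) (curvCube L i)))),
      ‖(((L : ℝ) ^ (i.K + 1))⁻¹)⁻¹ • (U μ (z' + unitVec (fine L (fine (L ^ i.K) (curvCube L i))) ν + unitVec (fine L (fine (L ^ i.K) (curvCube L i))) μ) -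
          U μ (z' + unitVec (fine L (fine (L ^ i.K) (curvCube L i))) ν)) -
        (((L : ℝ) ^ (i.K + 1))⁻¹)⁻¹ • (U μ (z' + unitVec (fine L (fine (L ^ i.K) (curvCube L i))) μ) - U μ z')‖ ≤ ((L : ℝ) ^ (i.K + 1))⁻¹ * a₄ :=
    fun μ ν z' => (hsecA μ ν z').trans (mul_le_mul_of_nonneg_left (hct.trans hta₄) (by positivity))
  -- part XXXII's pair defect at this level
  have hD := H₄ i.K i.one_le_K i.m (curvCube L i) (fun _ => rfl) 0 le_rfl le_rfl i.Msz U hA' hgradA' hsecA' hskew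
  -- bookkeeping of the rate numbers
  have hθ0 : 0 ≤ ((L : ℝ) ^ i.K) ^ (-(1 / 2 / 2 : ℝ)) + ((L : ℝ) ^ i.K) ^ (-(1 / 2 : ℝ)) :=
    add_nonneg (Real.rpow_nonneg (pow_nonneg hLr _) _) (Real.rpow_nonneg (pow_nonneg hLr _) _)
  have hθ := theta_le_two_rpow hL1 i.K
  have hdom : ∀ y y' : Tor (curvCube L i),
      C₄ * (((L : ℝ) ^ i.K) ^ (-(1 / 2 / 2 : ℝ)) + ((L : ℝ) ^ i.K) ^ (-(1 / 2 : ℝ))) * Real.exp (-(δ₄ / 2 * tdistT (curvCube L i) y y')) ≤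
        2 * C₄ * ((L : ℝ) ^ i.K) ^ (-(1 / 4 : ℝ)) * Real.exp (-(δ₄ / 2 * tdistT (curvCube L i) y y')) := fun y y' => by
    refine mul_le_mul_of_nonneg_right ?_ (Real.exp_nonneg _)
    nlinarith [hC₄.le]
  refine ⟨?_, fun μ => ?_⟩
  · have h0 := hasMaj_projO_comp (g := unitTorusGeoS L i.K (curvCube L i) i.Msz)
      (liftBlk (blockOf (L ^ i.K) (curvCube L i) ∘ blockOf L (fine (L ^ i.K) (curvCube L i))) κ) hD none
    rw [← idef_projO_comp, ← curvXco_avg] at h0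
    exact h0.mono hdom
  · have h1 := hasMaj_projO_comp (g := unitTorusGeoS L i.K (curvCube L i) i.Msz)
      (liftBlk (blockOf (L ^ i.K) (curvCube L i) ∘ blockOf L (fine (L ^ i.K) (curvCube L i))) κ) hD (some (Sum.inl μ))
    rw [← idef_projO_comp, ← curvDxC_avg] at h1
    exact h1.mono hdom

end Letters01

/-! ## §3 ★★ `NE2PlusOperator` by name from the displayed rows of entries 2 and 3 -/

section Node

/-- ★★ **`NE2PlusOperator` BY NAME FOR THE CURVED KING FAMILY, FROM THE DISPLAYED ROWS OF ENTRIES 2 AND 3.**  With §2's rows of entries 0∕1 (discharged) and the displayed rows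
`h2`, `h3` (the θ-currency shape of §2: uniform `δ, C, b > 0`, majorant `C·(L^K)^{−¼}·e^{−δ|y−y′|_T}` in the window `M_sz·α₀ ≤ b`): `T4EtaRate.NE2PlusOperator c₃₅ curvPI curvKop` — one constant block `(M₅, δ₀, a₀, B₀, γ) = (1, min δ, min a, max C, ¼)`; sites of size 1 so the (3.42)
prefactors are `1` and the rate factor is `(L^K)^{−¼}` (n15-b `entryMajorant_le_etaRateShape`, `ne2PlusOperator_of_hasMaj`). [cite: Balaban1985BackgroundPropagators, Thm 3.1 (3.42) p.397 + Thm 3.14 pp.426–427 (quantifier template); King1986, Prop. 3.9 (3.73) p.665 (rate factor)] -/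
theorem ne2PlusOperator_curvKop_of_rows23 (he : ∀ X Y : Matrix n n ℂ, traceForm X Y = e X ⬝ᵥ e Y) (hLodd : Odd L) (hL : 2 ≤ L) (ha : 0 < a) (c35 : ℝ)
    (h2 : ∃ δ₂ C₂ b₂ : ℝ, 0 < δ₂ ∧ 0 < C₂ ∧ 0 < b₂ ∧
      ∀ (i : KingVolIndex d × Fin (d + 1)) (α₀ : ℝ), 0 < α₀ → i.1.Msz * α₀ ≤ b₂ → ∀ U : (curvBgF L n i.1).Cfg, (curvBgF L n i.1).Reg335 c35 α₀ U →
        HasMaj (BlockNorm.ofBlocks (unitTorusGeoS L i.1.K (curvCube L i.1) i.1.Msz) (liftBlk (blockOf (L ^ i.1.K) (curvCube L i.1)) κ))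
          (BlockNorm.ofBlocks (unitTorusGeoS L i.1.K (curvCube L i.1) i.1.Msz) (liftBlk (blockOf (L ^ i.1.K) (curvCube L i.1) ∘ blockOf L (fine (L ^ i.1.K) (curvCube L i.1))) κ))
          (curvOpT L κ e a i 2 U) (fun y y' => C₂ * ((L : ℝ) ^ i.1.K) ^ (-(1 / 4 : ℝ)) * Real.exp (-(δ₂ * tdistT (curvCube L i.1) y y'))))
    (h3 : ∃ δ₃ C₃ b₃ : ℝ, 0 < δ₃ ∧ 0 < C₃ ∧ 0 < b₃ ∧
      ∀ (i : KingVolIndex d × Fin (d + 1)) (α₀ : ℝ), 0 < α₀ → i.1.Msz * α₀ ≤ b₃ → ∀ U : (curvBgF L n i.1).Cfg, (curvBgF L n i.1).Reg335 c35 α₀ U →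
        HasMaj (BlockNorm.ofBlocks (unitTorusGeoS L i.1.K (curvCube L i.1) i.1.Msz) (liftBlk (blockOf (L ^ i.1.K) (curvCube L i.1)) κ))
          (BlockNorm.ofBlocks (unitTorusGeoS L i.1.K (curvCube L i.1) i.1.Msz) (liftBlk (blockOf (L ^ i.1.K) (curvCube L i.1) ∘ blockOf L (fine (L ^ i.1.K) (curvCube L i.1))) κ))
          (curvOpT L κ e a i 3 U) (fun y y' => C₃ * ((L : ℝ) ^ i.1.K) ^ (-(1 / 4 : ℝ)) * Real.exp (-(δ₃ * tdistT (curvCube L i.1) y y')))) :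
    NE2PlusOperator c35 (fun i : KingVolIndex d × Fin (d + 1) => curvPI L κ n i.1) (curvKop L κ e a) := by
  obtain ⟨δ₁, C₁, b₁, hδ₁, hC₁, hb₁, H₁⟩ := curvOp_letters01 (d := d) L κ e a he hLodd hL ha c35
  obtain ⟨δ₂, C₂, b₂, hδ₂, hC₂, hb₂, H₂⟩ := h2
  obtain ⟨δ₃, C₃, b₃, hδ₃, hC₃, hb₃, H₃⟩ := h3
  have hL0 : L ≠ 0 := by omega
  have hLr : (0 : ℝ) < (L : ℝ) := by exact_mod_cast (show 0 < L by omega)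
  -- ONE constant block
  set δ : ℝ := min δ₁ (min δ₂ δ₃) with hδdef
  set C : ℝ := max C₁ (max C₂ C₃) with hCdef
  set b : ℝ := min b₁ (min b₂ b₃) with hbdef
  have hδ : 0 < δ := lt_min hδ₁ (lt_min hδ₂ hδ₃)
  have hC : 0 < C := lt_max_of_lt_left hC₁
  have hb : 0 < b := lt_min hb₁ (lt_min hb₂ hb₃)
  have hdδ₁ : δ ≤ δ₁ := min_le_left _ _
  have hdδ₂ : δ ≤ δ₂ := (min_le_right _ _).trans (min_le_left _ _)
  have hdδ₃ : δ ≤ δ₃ := (min_le_right _ _).trans (min_le_right _ _)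
  have hCC₁ : C₁ ≤ C := le_max_left _ _
  have hCC₂ : C₂ ≤ C := le_max_of_le_right (le_max_left _ _)
  have hCC₃ : C₃ ≤ C := le_max_of_le_right (le_max_right _ _)
  have hbb₁ : b ≤ b₁ := min_le_left _ _
  have hbb₂ : b ≤ b₂ := (min_le_right _ _).trans (min_le_left _ _)
  have hbb₃ : b ≤ b₃ := (min_le_right _ _).trans (min_le_right _ _)
  refine ne2PlusOperator_of_hasMaj (I := KingVolIndex d × Fin (d + 1)) (fun i => unitTorusGeoS L i.1.K (curvCube L i.1) i.1.Msz)
    (fun i => Tor (fine (L ^ i.1.K) (curvCube L i.1)) × κ) (fun i => Tor (fine L (fine (L ^ i.1.K) (curvCube L i.1))) × κ)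
    (fun i => liftBlk (blockOf (L ^ i.1.K) (curvCube L i.1)) κ) (fun i => liftBlk (blockOf (L ^ i.1.K) (curvCube L i.1) ∘ blockOf L (fine (L ^ i.1.K) (curvCube L i.1))) κ)
    (fun i => fineGeo (unitTorusGeoS L i.1.K (curvCube L i.1) i.1.Msz) (Tor (fine L (fine (L ^ i.1.K) (curvCube L i.1))) × κ)
      (liftBlk (blockOf (L ^ i.1.K) (curvCube L i.1) ∘ blockOf L (fine (L ^ i.1.K) (curvCube L i.1))) κ) 1)
    (fun i => curvBgC L n i.1) (fun i => curvBgF L n i.1) (fun i => curvPairing L κ i.1) (curvOpT L κ e a) c35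
    (fun i => by show (0 : ℝ) ≤ ((L : ℝ) ^ i.1.K)⁻¹; positivity) (fun i => hLr.le)
    ⟨1, δ, b, C, 1 / 4, one_pos, hδ, hb, hC, by norm_num, fun i _ α₀ hα₀ hMα U hU k => ?_⟩
  -- the θ-currency row of entry `k`, then the (3.42) domination
  have hθ0 : 0 ≤ ((L : ℝ) ^ i.1.K) ^ (-(1 / 4 : ℝ)) := Real.rpow_nonneg (pow_nonneg hLr.le _) _
  have hrow : HasMaj (BlockNorm.ofBlocks (unitTorusGeoS L i.1.K (curvCube L i.1) i.1.Msz) (liftBlk (blockOf (L ^ i.1.K) (curvCube L i.1)) κ))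
      (BlockNorm.ofBlocks (unitTorusGeoS L i.1.K (curvCube L i.1) i.1.Msz) (liftBlk (blockOf (L ^ i.1.K) (curvCube L i.1) ∘ blockOf L (fine (L ^ i.1.K) (curvCube L i.1))) κ))
      (curvOpT L κ e a i k U) (fun y y' => C * ((L : ℝ) ^ i.1.K) ^ (-(1 / 4 : ℝ)) * Real.exp (-(δ * tdistT (curvCube L i.1) y y'))) := by
    have hw : ∀ {C' δ' : ℝ}, 0 < C' → C' ≤ C → δ ≤ δ' →
        HasMaj (BlockNorm.ofBlocks (unitTorusGeoS L i.1.K (curvCube L i.1) i.1.Msz) (liftBlk (blockOf (L ^ i.1.K) (curvCube L i.1)) κ))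
          (BlockNorm.ofBlocks (unitTorusGeoS L i.1.K (curvCube L i.1) i.1.Msz) (liftBlk (blockOf (L ^ i.1.K) (curvCube L i.1) ∘ blockOf L (fine (L ^ i.1.K) (curvCube L i.1))) κ))
          (curvOpT L κ e a i k U) (fun y y' => C' * ((L : ℝ) ^ i.1.K) ^ (-(1 / 4 : ℝ)) * Real.exp (-(δ' * tdistT (curvCube L i.1) y y'))) →
        HasMaj (BlockNorm.ofBlocks (unitTorusGeoS L i.1.K (curvCube L i.1) i.1.Msz) (liftBlk (blockOf (L ^ i.1.K) (curvCube L i.1)) κ))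
          (BlockNorm.ofBlocks (unitTorusGeoS L i.1.K (curvCube L i.1) i.1.Msz) (liftBlk (blockOf (L ^ i.1.K) (curvCube L i.1) ∘ blockOf L (fine (L ^ i.1.K) (curvCube L i.1))) κ))
          (curvOpT L κ e a i k U) (fun y y' => C * ((L : ℝ) ^ i.1.K) ^ (-(1 / 4 : ℝ)) * Real.exp (-(δ * tdistT (curvCube L i.1) y y'))) :=
      fun hC' hCC hδδ h => hasMaj_exp_weaken L (mul_nonneg hC'.le hθ0) (mul_le_mul_of_nonneg_right hCC hθ0) hδδ h
    fin_cases k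
    · exact hw hC₁ hCC₁ hdδ₁ (H₁ i.1 α₀ hα₀ (hMα.trans hbb₁) U hU).1
    · exact hw hC₁ hCC₁ hdδ₁ ((H₁ i.1 α₀ hα₀ (hMα.trans hbb₁) U hU).2 i.2)
    · exact hw hC₂ hCC₂ hdδ₂ (H₂ i α₀ hα₀ (hMα.trans hbb₂) U hU)
    · exact hw hC₃ hCC₃ hdδ₃ (H₃ i α₀ hα₀ (hMα.trans hbb₃) U hU)
  refine hrow.mono fun y y' => ?_
  exact entryMajorant_le_etaRateShape (liftBlk (blockOf (L ^ i.1.K) (curvCube L i.1)) κ) (X := Tor (fine (L ^ i.1.K) (curvCube L i.1)) × κ)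
    (by show (0 : ℝ) < ((L : ℝ) ^ i.1.K)⁻¹; positivity) hLr (fun y => (unitTorusGeoS_len_eq L hL0 i.1.K (curvCube L i.1) i.1.Msz y).symm.le) hθ0
    (fun y => (rateWeight_unitTorusGeoS L (curvCube L i.1) i.1.K i.1.Msz (1 / 4) y).symm.le) hC.le le_rfl k y y'

end Node

end Summit.QuantumFields.YangMills.BalabanUVNodes.N15.SiteLayerBg

end
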